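import Summits.KontsevichZagierPeriods.KontsevichZagierPeriods.Theses.LiouvilleUnfolding
import Literature.NumberTheory.Transcendental.KZSubcalculusInvariants
import Literature.NumberTheory.Transcendental.KZKernelConjectureForms
import Literature.NumberTheory.Transcendental.KZLogCalculus

/-!
# `LogKernelConjecture` (stmt-KontsevichZagierPeriods-2837) — negative knowledge, part 1: the sandwich

Route LiouvilleUnfolding, crux `LogKernelConjecture` ("open core"): for every subgroup
`R ≥ KZ.relations` closed under the semantic logarithmic Newton–Leibniz rule of the sibling crux
`LogPrimitiveNL` (stmt-2836), `ker KZ.eval ⊆ R`.  This file (cdisprove seat, cycle 1) records, as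
kernel-checked theorems:

* §1 the closure hypothesis `ClosedUnderLogNL R`, the instance set `logNLInstances`, the five-rule
  relation group `logClosure`, and `LogKernelConjecture ↔ ker eval ≤ logClosure`;
* §2 SOUNDNESS of the semantic log rule (Fubini + fibrewise FTC for `Σ hᵢ(x) log Vᵢ(x,t)`): so
  `ker eval` is a member of the family and the crux is the equality `logClosure = ker eval`;
* §3 the sandwich `KZKernelConjecture → LogKernelConjecture`, `LogPrimitiveNL → LogKernelConjecture
  → KZKernelConjecture`, and **`KontsevichZagierPeriods ↔ LogPrimitiveNL ∧ LogKernelConjecture`** —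
  each crux of the route is implied by the summit, so a kill of either is a disproof of
  Conjecture 1 of [Kontsevich–Zagier 2001, §1.2] in kernel form;
* §4 `¬ LogKernelConjecture ↔` an exotic additive invariant of the five-rule calculus exists
  (kills the four moves and the log instances, not `eval`-trivial); the tree's `KZ.coeffSum` is the
  nearest miss (kills the log instances, dies on additivity).
[cite: KontsevichZagierPeriods2001, §1.2 Conjecture 1] [cite: HuberMullerStachPeriods2017, Conj. 13.2.1]
-/

noncomputable section

open MeasureTheory Set
open Literature.NumberTheory.Transcendental

namespace Summit.KontsevichZagierPeriods.LiouvilleUnfolding.LogKernelConjectureNegative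

open Summit.KontsevichZagierPeriods.KontsevichZagierPeriods.Theses.LiouvilleUnfolding
  (LogKernelConjecture LogPrimitiveNL)

/-! ## §1 Vocabulary: the closure hypothesis, the instance set, the closure subgroup -/

/-- The closure hypothesis of the crux, VERBATIM: `R` contains `[r] − [r']` for every instance of
the semantic logarithmic Newton–Leibniz rule of `LogPrimitiveNL`. [folklore] -/
def ClosedUnderLogNL (R : AddSubgroup KZ.FormalRep) : Prop :=
  ∀ (n k : ℕ) (r : KZ.IntegralRep (n + 1)) (r' : KZ.IntegralRep n) (a b : (Fin n → ℝ) → ℝ)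
    (h : Fin k → (Fin n → ℝ) → ℝ) (V V' : Fin k → (Fin (n + 1) → ℝ) → ℝ),
    IsSemialgebraicFunOn ℚ r'.domain a → IsSemialgebraicFunOn ℚ r'.domain b →
    (∀ x ∈ r'.domain, a x ≤ b x) →
    r.domain = {z | (Fin.init z : Fin n → ℝ) ∈ r'.domain ∧ a (Fin.init z) ≤ z (Fin.last n) ∧
      z (Fin.last n) ≤ b (Fin.init z)} →
    (∀ i, IsSemialgebraicFunOn ℚ r'.domain (h i)) →
    (∀ i, IsSemialgebraicFunOn ℚ r.domain (V i)) →
    (∀ i, ∀ z ∈ r.domain, 0 < V i z) →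
    (∀ i, ∀ x ∈ r'.domain, ContinuousOn (fun t : ℝ => V i (Fin.snoc x t)) (Set.Icc (a x) (b x))) →
    (∀ i, ∀ x ∈ r'.domain, ∀ t ∈ Set.Ioo (a x) (b x),
      HasDerivAt (fun s : ℝ => V i (Fin.snoc x s)) (V' i (Fin.snoc x t)) t) →
    (∀ i, IntegrableOn (fun z => h i (Fin.init z) * V' i z / V i z) r.domain) →
    (∀ x ∈ r'.domain, ∀ t ∈ Set.Ioo (a x) (b x),
      r.integrand (Fin.snoc x t) = ∑ i, h i x * V' i (Fin.snoc x t) / V i (Fin.snoc x t)) →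
    (∀ x ∈ r'.domain, r'.integrand x =
      ∑ i, h i x * (Real.log (V i (Fin.snoc x (b x))) - Real.log (V i (Fin.snoc x (a x))))) →
    KZ.of r - KZ.of r' ∈ R

/-- The SET of instances `[r] − [r']` of the semantic logarithmic Newton–Leibniz rule (same
hypotheses as in the crux, bundled existentially). [folklore] -/
def logNLInstances : Set KZ.FormalRep :=
  {c | ∃ (n k : ℕ) (r : KZ.IntegralRep (n + 1)) (r' : KZ.IntegralRep n) (a b : (Fin n → ℝ) → ℝ)
    (h : Fin k → (Fin n → ℝ) → ℝ) (V V' : Fin k → (Fin (n + 1) → ℝ) → ℝ),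
    IsSemialgebraicFunOn ℚ r'.domain a ∧ IsSemialgebraicFunOn ℚ r'.domain b ∧
    (∀ x ∈ r'.domain, a x ≤ b x) ∧
    r.domain = {z | (Fin.init z : Fin n → ℝ) ∈ r'.domain ∧ a (Fin.init z) ≤ z (Fin.last n) ∧
      z (Fin.last n) ≤ b (Fin.init z)} ∧
    (∀ i, IsSemialgebraicFunOn ℚ r'.domain (h i)) ∧
    (∀ i, IsSemialgebraicFunOn ℚ r.domain (V i)) ∧
    (∀ i, ∀ z ∈ r.domain, 0 < V i z) ∧
    (∀ i, ∀ x ∈ r'.domain, ContinuousOn (fun t : ℝ => V i (Fin.snoc x t)) (Set.Icc (a x) (b x))) ∧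
    (∀ i, ∀ x ∈ r'.domain, ∀ t ∈ Set.Ioo (a x) (b x),
      HasDerivAt (fun s : ℝ => V i (Fin.snoc x s)) (V' i (Fin.snoc x t)) t) ∧
    (∀ i, IntegrableOn (fun z => h i (Fin.init z) * V' i z / V i z) r.domain) ∧
    (∀ x ∈ r'.domain, ∀ t ∈ Set.Ioo (a x) (b x),
      r.integrand (Fin.snoc x t) = ∑ i, h i x * V' i (Fin.snoc x t) / V i (Fin.snoc x t)) ∧
    (∀ x ∈ r'.domain, r'.integrand x =
      ∑ i, h i x * (Real.log (V i (Fin.snoc x (b x))) - Real.log (V i (Fin.snoc x (a x))))) ∧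
    c = KZ.of r - KZ.of r'}

/-- The closure hypothesis says exactly `logNLInstances ⊆ R`. [folklore] -/
theorem closedUnderLogNL_iff_subset (R : AddSubgroup KZ.FormalRep) :
    ClosedUnderLogNL R ↔ logNLInstances ⊆ (R : Set KZ.FormalRep) := by
  constructor
  · rintro hR c ⟨n, k, r, r', a, b, h, V, V', ha, hb, hab, hdom, hh, hV, hpos, hcont, hder, hint,
      hr, hr', rfl⟩
    exact hR n k r r' a b h V V' ha hb hab hdom hh hV hpos hcont hder hint hr hr'
  · intro hR n k r r' a b h V V' ha hb hab hdom hh hV hpos hcont hder hint hr hr'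
    exact hR ⟨n, k, r, r', a, b, h, V, V', ha, hb, hab, hdom, hh, hV, hpos, hcont, hder, hint, hr,
      hr', rfl⟩

/-- The subgroup generated by the four KZ moves together with the logarithmic instances: the
relations of the FIVE-rule calculus. [folklore] -/
def logClosure : AddSubgroup KZ.FormalRep :=
  AddSubgroup.closure ((KZ.relations : Set KZ.FormalRep) ∪ logNLInstances)

/-- `KZ.relations ≤ logClosure`. [folklore] -/
theorem relations_le_logClosure : KZ.relations ≤ logClosure := fun _ hc =>
  AddSubgroup.subset_closure (Or.inl hc)

/-- `logNLInstances ⊆ logClosure`. [folklore] -/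
theorem logNLInstances_subset_logClosure : logNLInstances ⊆ (logClosure : Set KZ.FormalRep) :=
  fun _ hc => AddSubgroup.subset_closure (Or.inr hc)

/-- `logClosure` is closed under the log rule. [folklore] -/
theorem closedUnderLogNL_logClosure : ClosedUnderLogNL logClosure :=
  (closedUnderLogNL_iff_subset _).2 logNLInstances_subset_logClosure

/-- `logClosure` is the least member of the family quantified over in the crux. [folklore] -/
theorem logClosure_le {R : AddSubgroup KZ.FormalRep} (hrel : KZ.relations ≤ R)
    (hR : ClosedUnderLogNL R) : logClosure ≤ R := by
  rw [logClosure, AddSubgroup.closure_le]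
  rintro c (hc | hc)
  · exact hrel hc
  · exact (closedUnderLogNL_iff_subset R).1 hR hc

/-- Unfolding (definitional): the crux, with the closure hypothesis named. [folklore] -/
theorem logKernelConjecture_iff :
    LogKernelConjecture ↔
      ∀ R : AddSubgroup KZ.FormalRep, KZ.relations ≤ R → ClosedUnderLogNL R →
        ∀ c : KZ.FormalRep, KZ.eval c = 0 → c ∈ R :=
  Iff.rfl

/-- **The crux says exactly `ker eval ≤ logClosure`** (the period conjecture for the five-rule
calculus, as its docstring announces). [folklore] -/
theorem logKernelConjecture_iff_ker_le : LogKernelConjecture ↔ KZ.eval.ker ≤ logClosure := by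
  rw [logKernelConjecture_iff]
  constructor
  · intro h c hc
    exact h logClosure relations_le_logClosure closedUnderLogNL_logClosure c hc
  · intro h R hrel hR c hc
    exact logClosure_le hrel hR (h (by exact hc))


/-! ## §2 Soundness of the semantic logarithmic rule: `ker eval` is in the family -/

/-- **Soundness of the logarithmic Newton–Leibniz instances.** Every instance `[r] − [r']` has
value `0`: Fubini along the last coordinate and the fibrewise fundamental theorem of calculus for
the primitive `F (x, t) = Σᵢ hᵢ(x) · log Vᵢ(x, t)` (continuous on the closed fibre because `Vᵢ > 0`
is continuous there; derivative `Σᵢ hᵢ Vᵢ'/Vᵢ = r.integrand` on the open fibre), via the tree's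
band lemma `KZlog.setIntegral_band_eq_of_hasDerivAt`.  Only `hab`, `hdom`, `hpos` (as `≠ 0`),
`hcont`, `hder`, `hr`, `hr'` and `r.integrableOn` are used: the semialgebraicity hypotheses on
`a, b, hᵢ, Vᵢ` and termwise integrability play no role in soundness. [Kontsevich–Zagier 2001,
§1.2 rule (3)] [folklore] -/
theorem eval_eq_zero_of_mem_logNLInstances {c : KZ.FormalRep} (hc : c ∈ logNLInstances) :
    KZ.eval c = 0 := by
  obtain ⟨n, k, r, r', a, b, h, V, V', -, -, hab, hdom, -, -, hpos, hcont, hder, -, hr, hr',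
    rfl⟩ := hc
  rw [map_sub, KZ.eval_of, KZ.eval_of, sub_eq_zero, KZ.IntegralRep.value, KZ.IntegralRep.value]
  have hτ : MeasurableSet r'.domain := KZ.IntegralRep.measurableSet_domain_holds r'
  have hB : MeasurableSet r.domain := KZ.IntegralRep.measurableSet_domain_holds r
  have hdom' : r.domain = KZlog.band r'.domain a b := hdom
  have hmem : ∀ x ∈ r'.domain, ∀ t ∈ Icc (a x) (b x), (Fin.snoc x t : Fin (n + 1) → ℝ) ∈ r.domain :=
    fun x hx t ht => by rw [hdom']; exact KZlog.snoc_mem_band.2 ⟨hx, ht⟩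
  have hint : IntegrableOn r.integrand (KZlog.band r'.domain a b) := hdom' ▸ r.integrableOn
  rw [hdom'] at hB ⊢
  rw [KZlog.setIntegral_band_eq_of_hasDerivAt hτ hab hB (G := r.integrand)
    (F := fun z => ∑ i, h i (Fin.init z) * Real.log (V i z)) hint ?_ ?_]
  · refine setIntegral_congr_fun hτ fun x hx => ?_
    simp only [Fin.init_snoc]
    rw [hr' x hx, ← Finset.sum_sub_distrib]
    exact Finset.sum_congr rfl fun i _ => by ring
  · intro x hx
    simp only [Fin.init_snoc]
    refine continuousOn_finsetSum _ fun i _ => continuousOn_const.mul ?_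
    exact (hcont i x hx).log fun t ht => (hpos i _ (hmem x hx t ht)).ne'
  · intro x hx t ht
    rw [hr x hx t ht]
    simp only [Fin.init_snoc]
    exact HasDerivAt.fun_sum (u := Finset.univ)
      (A := fun i (s : ℝ) => h i x * Real.log (V i (Fin.snoc x s)))
      (A' := fun i => h i x * V' i (Fin.snoc x t) / V i (Fin.snoc x t)) (x := t) fun i _ => by
        have hVt : V i (Fin.snoc x t) ≠ 0 := (hpos i _ (hmem x hx t (Ioo_subset_Icc_self ht))).ne'
        have := ((hder i x hx t ht).log hVt).const_mul (h i x)
        simpa [mul_div_assoc] using this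

/-- `logNLInstances ⊆ ker eval`. [folklore] -/
theorem logNLInstances_subset_ker : logNLInstances ⊆ (KZ.eval.ker : Set KZ.FormalRep) :=
  fun _ hc => (AddMonoidHom.mem_ker).2 (eval_eq_zero_of_mem_logNLInstances hc)

/-- **`ker eval` is closed under the log rule**: it is a member of the family the crux quantifies
over (non-vacuity of the hypotheses at the intended model). [folklore] -/
theorem closedUnderLogNL_ker : ClosedUnderLogNL KZ.eval.ker :=
  (closedUnderLogNL_iff_subset _).2 logNLInstances_subset_ker

/-- `relations ≤ ker eval` (soundness of the four moves, tree theorem). [folklore] -/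
theorem relations_le_ker : KZ.relations ≤ KZ.eval.ker := KZ.relations_le_ker_eval_holds

/-- **`logClosure ≤ ker eval`**: the five-rule calculus is sound. [folklore] -/
theorem logClosure_le_ker : logClosure ≤ KZ.eval.ker := logClosure_le relations_le_ker closedUnderLogNL_ker

/-- **The crux is the equality `logClosure = ker eval`** (tightness: the conclusion `ker eval ≤ R`
cannot be asked of any `R` below `logClosure`, and `logClosure` itself lies in the kernel).
[folklore] -/
theorem logKernelConjecture_iff_eq : LogKernelConjecture ↔ logClosure = KZ.eval.ker := by
  rw [logKernelConjecture_iff_ker_le]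
  exact ⟨fun h => le_antisymm logClosure_le_ker h, fun h => h.ge⟩


/-! ## §3 The sandwich: the two cruxes of the route are jointly equivalent to the summit -/

/-- **Summit (kernel form) ⇒ crux**: `relations ≤ R` and `ker eval = relations` give
`ker eval ≤ R`; the closure hypothesis is not even used. [folklore] -/
theorem of_kzKernelConjecture (hk : KZKernelConjecture) : LogKernelConjecture :=
  fun _ hR _ c hc => hR (hk c hc)

/-- `LogPrimitiveNL` (stmt-2836) says exactly that the logarithmic instances are ordinary KZ
relations. [folklore] -/
theorem logPrimitiveNL_iff_subset :
    LogPrimitiveNL ↔ logNLInstances ⊆ (KZ.relations : Set KZ.FormalRep) :=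
  (closedUnderLogNL_iff_subset KZ.relations)

/-- Equivalently, `LogPrimitiveNL ↔ logClosure = KZ.relations`. [folklore] -/
theorem logPrimitiveNL_iff_logClosure_eq : LogPrimitiveNL ↔ logClosure = KZ.relations := by
  rw [logPrimitiveNL_iff_subset]
  constructor
  · intro h
    exact le_antisymm (logClosure_le le_rfl ((closedUnderLogNL_iff_subset _).2 h))
      relations_le_logClosure
  · intro h
    rw [← h]
    exact logNLInstances_subset_logClosure

/-- **Crux ∧ 2836 ⇒ summit (kernel form)** — the route's Assembly at `R := KZ.relations`.
[folklore] -/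
theorem kzKernelConjecture_of_logPrimitiveNL (h₁ : LogPrimitiveNL) (h₂ : LogKernelConjecture) :
    KZKernelConjecture :=
  h₂ KZ.relations le_rfl h₁

/-- **Summit ⇒ 2836**: the logarithmic instances are sound (§2), hence relations under the
kernel conjecture. So a refutation of `LogPrimitiveNL` ALSO refutes the period conjecture.
[folklore] -/
theorem logPrimitiveNL_of_kzKernelConjecture (hk : KZKernelConjecture) : LogPrimitiveNL :=
  logPrimitiveNL_iff_subset.2 fun _ hc => hk _ (eval_eq_zero_of_mem_logNLInstances hc)

/-- **`KZKernelConjecture ↔ LogPrimitiveNL ∧ LogKernelConjecture`.** [folklore] -/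
theorem kzKernelConjecture_iff_and :
    KZKernelConjecture ↔ LogPrimitiveNL ∧ LogKernelConjecture :=
  ⟨fun hk => ⟨logPrimitiveNL_of_kzKernelConjecture hk, of_kzKernelConjecture hk⟩,
    fun h => kzKernelConjecture_of_logPrimitiveNL h.1 h.2⟩

/-- The summit statement is the kernel conjecture (tree: `kzKernelConjecture_iff_isRational`, whose
right-hand side is the summit's body verbatim). [folklore] -/
theorem summit_iff_kzKernelConjecture : KontsevichZagierPeriods ↔ KZKernelConjecture :=
  kzKernelConjecture_iff_isRational.symm

/-- **`KontsevichZagierPeriods ↔ LogPrimitiveNL ∧ LogKernelConjecture`**: the route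
LiouvilleUnfolding is an EQUIVALENCE, not merely a sufficient decomposition; each crux is a
consequence of the summit. [folklore] -/
theorem summit_iff_logPrimitiveNL_and :
    KontsevichZagierPeriods ↔ LogPrimitiveNL ∧ LogKernelConjecture :=
  summit_iff_kzKernelConjecture.trans kzKernelConjecture_iff_and

/-- The summit implies the crux. [folklore] -/
theorem logKernelConjecture_of_summit (h : KontsevichZagierPeriods) : LogKernelConjecture :=
  (summit_iff_logPrimitiveNL_and.1 h).2

/-- The summit implies the sibling crux 2836. [folklore] -/
theorem logPrimitiveNL_of_summit (h : KontsevichZagierPeriods) : LogPrimitiveNL :=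
  (summit_iff_logPrimitiveNL_and.1 h).1

/-- **Contrapositive — what a kill costs**: `¬ LogKernelConjecture → ¬ KontsevichZagierPeriods`.
[folklore] -/
theorem not_summit_of_not_logKernelConjecture (h : ¬ LogKernelConjecture) :
    ¬ KontsevichZagierPeriods := fun hs => h (logKernelConjecture_of_summit hs)

/-! ## §4 What a kill must be: an exotic additive invariant of the five-rule calculus -/

/-- **`¬ LogKernelConjecture` iff an exotic invariant exists**: an additive map
`φ : KZ.FormalRep →+ A` which kills the four moves and every logarithmic instance but not some
combination of value `0`.  (`→`: `A := FormalRep ⧸ logClosure`, `φ := mk`; `←`: `ker φ` is a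
member of the family.)  This is the precise shape of any refutation; by §3 it would disprove
Conjecture 1 of [Kontsevich–Zagier 2001, §1.2] for this calculus. [folklore] -/
theorem not_logKernelConjecture_iff_invariant :
    ¬ LogKernelConjecture ↔
      ∃ (A : Type) (_ : AddCommGroup A) (φ : KZ.FormalRep →+ A),
        KZ.relations ≤ φ.ker ∧ logNLInstances ⊆ (φ.ker : Set KZ.FormalRep) ∧
        ∃ c : KZ.FormalRep, KZ.eval c = 0 ∧ φ c ≠ 0 := by
  rw [logKernelConjecture_iff_ker_le]
  constructor
  · intro h
    obtain ⟨c, hc, hcn⟩ : ∃ c, c ∈ KZ.eval.ker ∧ c ∉ logClosure := by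
      by_contra hno
      exact h fun c hc => by_contra fun hcn => hno ⟨c, hc, hcn⟩
    refine ⟨KZ.FormalRep ⧸ logClosure, inferInstance, QuotientAddGroup.mk' logClosure, ?_, ?_,
      c, hc, ?_⟩
    · intro d hd
      rw [AddMonoidHom.mem_ker, QuotientAddGroup.mk'_apply, QuotientAddGroup.eq_zero_iff]
      exact relations_le_logClosure hd
    · intro d hd
      rw [SetLike.mem_coe, AddMonoidHom.mem_ker, QuotientAddGroup.mk'_apply,
        QuotientAddGroup.eq_zero_iff]
      exact logNLInstances_subset_logClosure hd
    · rwa [Ne, QuotientAddGroup.mk'_apply, QuotientAddGroup.eq_zero_iff]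
  · rintro ⟨A, _, φ, hrel, hinst, c, hc, hφ⟩ h
    have hle : logClosure ≤ φ.ker := logClosure_le hrel ((closedUnderLogNL_iff_subset _).2 hinst)
    exact hφ ((AddMonoidHom.mem_ker).1 (hle (h ((AddMonoidHom.mem_ker).2 hc))))

/-- The coefficient-sum invariant of the tree kills every logarithmic instance (a difference of two
generators) … [folklore] -/
theorem coeffSum_eq_zero_of_mem_logNLInstances {c : KZ.FormalRep} (hc : c ∈ logNLInstances) :
    KZ.coeffSum c = 0 := by
  obtain ⟨n, k, r, r', a, b, h, V, V', -, -, -, -, -, -, -, -, -, -, -, -, rfl⟩ := hc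
  simp

/-- … but NOT the additivity moves (`coeffSum = −1` there, `KZ.coeffSum_eq_neg_one_of_mem_*`), so it
is not an exotic invariant in the sense of `not_logKernelConjecture_iff_invariant`: it fails
`relations ≤ ker`. Recorded as the nearest miss in the tree. [folklore] -/
theorem not_relations_le_ker_coeffSum : ¬ KZ.relations ≤ KZ.coeffSum.ker := by
  intro h
  have h1 : KZ.of (KZ.IntegralRep.empty 0) ∈ KZ.coeffSum.ker := h KZ.IntegralRep.of_empty_mem_relations
  rw [AddMonoidHom.mem_ker, KZ.coeffSum_of] at h1
  exact one_ne_zero h1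

end Summit.KontsevichZagierPeriods.LiouvilleUnfolding.LogKernelConjectureNegative
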